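import Literature.IUT.HodgeArakelov.MonoThetaProjectiveBridgeEtTh
import Literature.IUT.HodgeArakelov.MonoThetaProjectiveProofs

/-!
# [IUTchII] Prop. 1.5 (i) for the GENUINE model family: the reduction clause of [EtTh] Cor. 2.18 (iv)
# discharged, and Prop. 1.5 (i)′ modulo the two remaining Cor. 2.18 (iv) clauses (proof-only companion)

Proof-only companion (abc-iut cell, D-0067 wave 4, seat abc-iut-w4-d030; DAG node **IUTchII:Prop1.5(i)**,
GAP-LEDGER G-w4d030-1) of `MonoThetaProjectiveBridgeEtTh.lean` (bridge B8 part 5: the model family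
`EtaleLevels.modelFamily` of `X̲̲_K` over ALL `M ∈ ℕ_{≥1}` and its model reductions `EtaleLevels.reductions`, built
from an [EtTh] §1 theta setting) and of abc-iut-w4-d038's `MonoThetaProjectiveProofs.lean`
(`MonoThetaProjSystem.prop15_i'_of_cor218_iv`: the repaired node statement `Prop15_i'` for EVERY model family
modulo three clauses of [EtTh] Cor. 2.18 (iv) read at the models — `hred` reduction, `hlift` lifting from level
`1`, `hfin` finite fibre over the identity of level `1`). NO definition, NO new named fact.

Sources: S. Mochizuki, *Inter-universal Teichmüller theory II*, kurims manuscript (Dec. 2020), Prop. 1.5 (i)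
p. 29 [claim: Mochizuki2012, status: disputed] (IUTchII §1 Prop 1.5 (i), kurims p.29); S. Mochizuki, *The étale
theta function …*, Publ. RIMS **45** (2009), Cor. 2.18 (iv) p. 287 (PRIMS PDF p. 61): "the mod `M` mono-theta
environment `𝕄_M` determined by `𝕄` induces a natural homomorphism `Aut^μ(𝕄) → Aut^μ(𝕄_M)` with normal image" (the
superscript `μ` denoting `μ_N`-conjugacy classes of isomorphisms) [cite: MochizukiEtTh2009, Cor 2.18(iv) p.61].
v2 (doc-only, referee lane P DEFECT #180): the v1 header carried a paraphrase of this sentence inside quotation marks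
and dropped the superscript `μ`; repaired here by the verbatim sentence; no Lean content changed.

What is PROVED here:
* `EtaleLevels.red_descends` — **the clause `hred` HOLDS for the genuine model family**: every isomorphism of
  the mod-`M'` model mono-theta environment of `X̲̲_K` (abc-iut-L6-t1's `MonoThetaEnv.Iso` of `F.modelEnv M'`)
  induces one of the mod-`M` model along `red_{M',M}`, for ALL `M ∣ M'` in `ℕ_{≥1}` — transported from
  abc-iut-L2-d1's `DoubleUnderline.cor218_iv_reduction_model` (Cor. 2.18 (iv) for the [EtTh] §1 model TOWER) by
  pulling the chain-indexed statement down to the pair through `EtaleLevels.tower` and translating isomorphisms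
  through bridge B8 (`D_Y` read in `Aut` vs `Out`: `autToOut_outToAut`, `outToAut_map_transport`; the cocycle
  `red ∘ η⁰_{M'} = η⁰_M` by `ThetaEnvTower.exists_iso_congr`). Inputs, exactly as in L2-d1's theorem:
  temp-slimness of `Π^tp_X` (`IsSlimGroup D.PiTemp`, [SemiAnbd] Ex. 3.10, interface FACT) and openness of
  `Π^tp_X → G_K` (`haugOpen`, interface input reported by L2-d1).
* `EtaleLevels.prop15_i'_of_lift_of_finite` — hence, by d038's theorem, **[IUTchII] Prop. 1.5 (i)′ for the
  genuine model family** `Prop15_i' (EtaleLevels.reductions …) A B` for ALL projective systems `A`, `B`, modulo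
  the two remaining level-wise clauses of [EtTh] Cor. 2.18 (iv) read at the models of `X̲̲_K` (`hlift`: lifting
  `Aut(𝕄_1) → Aut(𝕄_M)`; `hfin`: finitely many automorphisms of `𝕄_M` over the identity of `𝕄_1`) — kept as
  explicit hypotheses here (their L2 forms are the level facts `ThetaEnvData.Cor218_iv_surjective` and
  `ThetaEnvData.Cor218_iv_fibre` + `ThetaEnvData.finite_autOverId`; transport = next companion).
HONEST FRAMING: conditional discharge; [IUTchII] claim key `Mochizuki2012` DISPUTED (D-0012); no side is taken
on [IUTchIII] Cor. 3.12; typed ≠ discharged elsewhere.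
-/

noncomputable section

namespace Literature.IUT.HodgeArakelov

open Literature.AnabelianGeometry.EtaleTheta Literature.AnabelianGeometry.SemiGraphs
open scoped Literature.AnabelianGeometry.EtaleTheta

namespace EtaleLevels

variable {p : ℕ} [Fact p.Prime] {D : Literature.AnabelianGeometry.EtaleTheta.ThetaSetting p}
  {E : D.EtaleThetaData} {l : ℕ} (C : E.DoubleUnderline l) (hC : D.Compat) (hS : D.Sec2Hyps)
  (hl : l.Prime) (hp2 : p ≠ 2) (hpl : p ≠ l) (hζ : ∃ ζ : D.K, IsPrimitiveRoot ζ (4 * l))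
  (mods : ∀ M : ℕ+, D.CyclotomeMod l M)
  (f : contCocycles D.toTheta D.DeltaTheta C.GtpYdduu) (hf : f ∈ C.rootCocycles hC)
  (hmods : ∀ (M M' : ℕ+) (h : (M : ℕ) ∣ (M' : ℕ)) (x : D.lDeltaTheta l),
    MuN.red p M M' h ((mods M').red x) = (mods M).red x)

/-! ## Isomorphisms of the model at level `M`: abc-iut-L6-t1's `MonoThetaEnv.Iso` vs abc-iut-L2-t2's
`(modelMono η⁰_M).Iso` -/

/-- An [IUTchII]-isomorphism of the model mono-theta environment at level `M` (abc-iut-L6-t1's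
`MonoThetaEnv.Iso`, `D_Y` read in `Aut`) restricts `D_Y ⊆ Out` to itself: it IS an [EtTh] Def. 2.13 (ii)
isomorphism of abc-iut-L2-t2's model `modelMono η⁰_M` (bridge B8: `autToOut_outToOut`).
[cite: MochizukiEtTh2009, Def 2.13(ii) p.48] -/
theorem map_transport_DY_of_iso (M : ℕ+)
    (φ : MonoThetaEnv.Iso ((modelFamily C hC hS hl hp2 hpl hζ mods f hf).modelEnv M)
      ((modelFamily C hC hS hl hp2 hpl hζ mods f hf).modelEnv M)) :
    (levelData C hC hS mods M).DY.map (TopOut.transport φ.iso) = (levelData C hC hS mods M).DY := by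
  have h1 := φ.toEtale.map_D
  have h2 : ((modelFamily C hC hS hl hp2 hpl hζ mods f hf).modelEnv M).toEtale.D = (levelData C hC hS mods M).DY := by
    change autToOut _ (outToAut _ (levelData C hC hS mods M).DY) = (levelData C hC hS mods M).DY
    exact autToOut_outToAut _
  rw [h2] at h1
  exact h1

/-- Conversely, an [EtTh] Def. 2.13 (ii) isomorphism of `modelMono η⁰_M` preserves `D_Y` read in `Aut`
(bridge B8: `outToAut_map_transport`), i.e. satisfies the `map_D` clause of abc-iut-L6-t1's `MonoThetaEnv.Iso`
for the model at level `M`. [cite: MochizukiEtTh2009, Def 2.13(ii) p.48] -/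
theorem map_congr_modelD_of_etaleIso (M : ℕ+)
    (β : ((levelData C hC hS mods M).modelMono (eta0_mem C hC hS mods f hf M)).Iso
      ((levelData C hC hS mods M).modelMono (eta0_mem C hC hS mods f hf M))) :
    ((modelFamily C hC hS hl hp2 hpl hζ mods f hf).modelEnv M).D.map
        (MulAut.congr β.e.toMulEquiv).toMonoidHom =
      ((modelFamily C hC hS hl hp2 hpl hζ mods f hf).modelEnv M).D := by
  haveI := (levelData C hC hS mods M).isTopologicalGroup_env
  have h3 := congrArg (outToAut (levelData C hC hS mods M).env) β.map_D
  rw [outToAut_map_transport] at h3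
  exact h3

/-! ## The reduction clause of [EtTh] Cor. 2.18 (iv) HOLDS at the genuine models -/

include hmods in
/-- **[EtTh] Cor. 2.18 (iv), reduction clause, for the model family of `X̲̲_K` over `ℕ_{≥1}`** (the hypothesis
`hred` of abc-iut-w4-d038's `prop15_i'_of_cor218_iv`, = `hdesc` of `prop15_i'_of_chainRigidity`): for ALL
`M ∣ M'`, every automorphism of the mod-`M'` model mono-theta environment induces, along `red_{M',M}`, an
automorphism of the mod-`M` model — transported from abc-iut-L2-d1's `DoubleUnderline.cor218_iv_reduction_model`
(the chain-indexed tower theorem, pulled down to the pair `M ∣ M'` via `EtaleLevels.tower`). Inputs: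
temp-slimness of `Π^tp_X` (`IsSlimGroup`, [SemiAnbd] Ex. 3.10) and openness of `Π^tp_X → G_K` (`haugOpen`).
[cite: MochizukiEtTh2009, Cor 2.18(iv) p.61] -/
theorem red_descends (hslimX : Literature.AlgebraicGeometry.Frobenioids.IsSlimGroup D.PiTemp)
    (haugOpen : IsOpenMap D.aug) (M M' : ℕ+) (h : (M : ℕ) ∣ (M' : ℕ))
    (φ' : MonoThetaEnv.Iso ((modelFamily C hC hS hl hp2 hpl hζ mods f hf).modelEnv M')
      ((modelFamily C hC hS hl hp2 hpl hζ mods f hf).modelEnv M')) :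
    ∃ φ : MonoThetaEnv.Iso ((modelFamily C hC hS hl hp2 hpl hζ mods f hf).modelEnv M)
        ((modelFamily C hC hS hl hp2 hpl hζ mods f hf).modelEnv M),
      ∀ x, (reductions C hC hS hl hp2 hpl hζ mods f hf hmods hslimX).red h (φ'.iso x) =
        φ.iso ((reductions C hC hS hl hp2 hpl hζ mods f hf hmods hslimX).red h x) := by
  -- the [EtTh] isomorphism of `modelMono η⁰_{M'}` underlying `φ'`
  let α' : ((levelData C hC hS mods M').modelMono (eta0_mem C hC hS mods f hf M')).Iso
      ((levelData C hC hS mods M').modelMono (eta0_mem C hC hS mods f hf M')) :=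
    { e := φ'.iso
      map_D := map_transport_DY_of_iso C hC hS hl hp2 hpl hζ mods f hf M' φ'
      map_sTheta := φ'.map_theta }
  -- Cor. 2.18 (iv), reduction, on the chain through `M ∣ M'`
  obtain ⟨α, hα⟩ := C.cor218_iv_reduction_model (cyclotomeTower mods hmods h) hC hS hslimX haugOpen
    (low h) (high h) (low_dvd_high h) (eta0 C hC mods f hf M') (eta0_mem C hC hS mods f hf M') α'
  -- move the reduced model to the cocycle `η⁰_M` (`red ∘ η⁰_{M'} = η⁰_M`)
  have hη : (tower C hC hS mods hmods h).red (low h) (high h) (low_dvd_high h) ∘ eta0 C hC mods f hf M' =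
      eta0 C hC mods f hf M :=
    C.red_comp_modN (cyclotomeTower mods hmods h) (low_dvd_high h) f hf.1
  obtain ⟨β, hβ⟩ := ThetaEnvTower.exists_iso_congr (T := tower C hC hS mods hmods h) (M := low h) hη
    ((tower C hC hS mods hmods h).red_cocycle_mem (low h) (high h) (low_dvd_high h) _
      (eta0_mem C hC hS mods f hf M')) (eta0_mem C hC hS mods f hf M) α
  -- read `β` back as an [IUTchII]-isomorphism of the model at level `M`
  refine ⟨{ iso := β.e
            map_D := map_congr_modelD_of_etaleIso C hC hS hl hp2 hpl hζ mods f hf M β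
            map_theta := β.map_sTheta }, fun x => ?_⟩
  have e1 : (tower C hC hS mods hmods h).redEnv (low h) (high h) (low_dvd_high h) (φ'.iso x) =
      α.e ((tower C hC hS mods hmods h).redEnv (low h) (high h) (low_dvd_high h) x) := hα x
  have e2 : β.e ((tower C hC hS mods hmods h).redEnv (low h) (high h) (low_dvd_high h) x) =
      α.e ((tower C hC hS mods hmods h).redEnv (low h) (high h) (low_dvd_high h) x) :=
    DFunLike.congr_fun hβ _
  exact e1.trans e2.symm

include hmods in
/-- **[IUTchII] Prop. 1.5 (i)′ FOR THE GENUINE MODEL FAMILY of `X̲̲_K`, modulo the two remaining clauses of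
[EtTh] Cor. 2.18 (iv) read at the models** (abc-iut-w4-d038's `prop15_i'_of_cor218_iv` with its `hred` clause
DISCHARGED by `red_descends`): for every pair of projective systems `A`, `B` of mono-theta environments of
`X̲̲_K` indexed by ALL of `ℕ_{≥1}` whose transitions are morphisms of mono-theta environments, `A` and `B` are
compatibly isomorphic — GIVEN `hlift` (every automorphism of the mod-`1` model lifts to the mod-`M` model;
L2 level fact `ThetaEnvData.Cor218_iv_surjective`) and `hfin` (finitely many automorphisms of the mod-`M` model
over the identity of the mod-`1` model; L2 `ThetaEnvData.Cor218_iv_fibre` / `finite_autOverId`), plus the inputs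
of `red_descends`. [claim: Mochizuki2012, status: disputed] (IUTchII §1 Prop 1.5 (i), kurims p.29) -/
theorem prop15_i'_of_lift_of_finite (hslimX : Literature.AlgebraicGeometry.Frobenioids.IsSlimGroup D.PiTemp)
    (haugOpen : IsOpenMap D.aug)
    (hlift : ∀ (M : ℕ+) (φ : MonoThetaEnv.Iso ((modelFamily C hC hS hl hp2 hpl hζ mods f hf).modelEnv 1)
        ((modelFamily C hC hS hl hp2 hpl hζ mods f hf).modelEnv 1)),
      ∃ ψ : MonoThetaEnv.Iso ((modelFamily C hC hS hl hp2 hpl hζ mods f hf).modelEnv M)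
          ((modelFamily C hC hS hl hp2 hpl hζ mods f hf).modelEnv M),
        ∀ x, (reductions C hC hS hl hp2 hpl hζ mods f hf hmods hslimX).red (PNat.dvd_iff.mp (one_dvd M))
            (ψ.iso x) =
          φ.iso ((reductions C hC hS hl hp2 hpl hζ mods f hf hmods hslimX).red (PNat.dvd_iff.mp (one_dvd M)) x))
    (hfin : ∀ M : ℕ+, Set.Finite
      {φ : MonoThetaEnv.Iso ((modelFamily C hC hS hl hp2 hpl hζ mods f hf).modelEnv M)
          ((modelFamily C hC hS hl hp2 hpl hζ mods f hf).modelEnv M) |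
        ∀ x, (reductions C hC hS hl hp2 hpl hζ mods f hf hmods hslimX).red (PNat.dvd_iff.mp (one_dvd M))
            (φ.iso x) =
          (reductions C hC hS hl hp2 hpl hζ mods f hf hmods hslimX).red (PNat.dvd_iff.mp (one_dvd M)) x})
    (A B : MonoThetaProjSystem (modelFamily C hC hS hl hp2 hpl hζ mods f hf)) :
    Literature.IUT.HodgeArakelov.Prop15_i' (reductions C hC hS hl hp2 hpl hζ mods f hf hmods hslimX) A B :=
  MonoThetaProjSystem.prop15_i'_of_cor218_iv _
    (fun M M' h φ' => red_descends C hC hS hl hp2 hpl hζ mods f hf hmods hslimX haugOpen M M' h φ')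
    hlift hfin A B


/-! ## The two level-wise clauses of [EtTh] Cor. 2.18 (iv) at the genuine models, from L2's level facts -/

/-- The cyclotome `μ_1` is trivial. [cite: MochizukiEtTh2009, Def 2.13(ii) p.48] -/
theorem subsingleton_MuN_one : Subsingleton (MuN p 1) :=
  Fintype.card_le_one_iff_subsingleton.mp (card_MuN p 1).le

include hmods in
/-- **[EtTh] Cor. 2.18 (iv), lifting clause `Aut(𝕄_1) → Aut(𝕄_M)`, for the model family of `X̲̲_K`** (the
hypothesis `hlift` of abc-iut-w4-d038's `prop15_i'_of_cor218_iv`): every automorphism of the mod-`1` model lifts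
along `red_{M,1}` to the mod-`M` model. Route: an automorphism of the mod-`1` model lies over an automorphism
`γ` of `Π^tp_X̲̲` preserving `Π^tp_Y̲̲` (abc-iut-L2-d1's `exists_continuousMulEquiv_PiX_of_iso`, from temp-slimness);
`γ` lifts to the mod-`M` model by the level fact `ThetaEnvData.Cor218_iv_surjective` ([EtTh] Cor. 2.18 (iv),
first half); the lift reduces to the given automorphism because `μ_1` is trivial. Inputs: `IsSlimGroup D.PiTemp`
and the level-`M` named fact `Cor218_iv_surjective`. [cite: MochizukiEtTh2009, Cor 2.18(iv) p.61] -/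
theorem red_lifts (hslimX : Literature.AlgebraicGeometry.Frobenioids.IsSlimGroup D.PiTemp)
    (hsurj : ∀ M : ℕ+, (levelData C hC hS mods M).Cor218_iv_surjective) (M : ℕ+)
    (φ : MonoThetaEnv.Iso ((modelFamily C hC hS hl hp2 hpl hζ mods f hf).modelEnv 1)
      ((modelFamily C hC hS hl hp2 hpl hζ mods f hf).modelEnv 1)) :
    ∃ ψ : MonoThetaEnv.Iso ((modelFamily C hC hS hl hp2 hpl hζ mods f hf).modelEnv M)
        ((modelFamily C hC hS hl hp2 hpl hζ mods f hf).modelEnv M),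
      ∀ x, (reductions C hC hS hl hp2 hpl hζ mods f hf hmods hslimX).red (PNat.dvd_iff.mp (one_dvd M))
          (ψ.iso x) =
        φ.iso ((reductions C hC hS hl hp2 hpl hζ mods f hf hmods hslimX).red (PNat.dvd_iff.mp (one_dvd M)) x) := by
  have h1 : ((1 : ℕ+) : ℕ) ∣ (M : ℕ) := PNat.dvd_iff.mp (one_dvd M)
  -- the [EtTh] isomorphism of `modelMono η⁰_1` underlying `φ`
  let α₁ : ((levelData C hC hS mods 1).modelMono (eta0_mem C hC hS mods f hf 1)).Iso
      ((levelData C hC hS mods 1).modelMono (eta0_mem C hC hS mods f hf 1)) :=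
    { e := φ.iso
      map_D := map_transport_DY_of_iso C hC hS hl hp2 hpl hζ mods f hf 1 φ
      map_sTheta := φ.map_theta }
  -- Cor. 2.18 (iii) on the chain through `1 ∣ M` (temp-slimness)
  have h218 := (tower C hC hS mods hmods h1).cor218_iii_of_tempSlim (C.tempSlim_Huu hslimX)
  have hker := (tower C hC hS mods hmods h1).map_ker_eq_of_contMulAut (low h1) (h218.2 (low h1))
    ⟨α₁.e.toMulEquiv, α₁.e.continuous, α₁.e.symm.continuous⟩
  -- `α₁` lies over an automorphism `γ` of `Π^tp_X̲̲`
  obtain ⟨γ, hγ⟩ := ThetaEnvData.exists_continuousMulEquiv_PiX_of_iso α₁ hker h218.1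
  -- `γ` preserves `Π^tp_Y̲̲`
  have hPiY : (levelData C hC hS mods M).PiY.map γ.toMulEquiv.toMonoidHom = (levelData C hC hS mods M).PiY := by
    ext q
    constructor
    · rintro ⟨y, hy, rfl⟩
      have e1 := hγ (CycEnvelope.algSection (levelData C hC hS mods 1).augY (levelData C hC hS mods 1).chi ⟨y, hy⟩)
      change ((α₁.e _).right : C.Huu) = γ y at e1
      change γ y ∈ (levelData C hC hS mods M).PiY
      rw [← e1]
      exact (α₁.e _).right.2
    · intro hq
      refine ⟨((α₁.e.symm (CycEnvelope.algSection (levelData C hC hS mods 1).augY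
        (levelData C hC hS mods 1).chi ⟨q, hq⟩)).right : C.Huu), (α₁.e.symm _).right.2, ?_⟩
      have e1 := hγ (α₁.e.symm (CycEnvelope.algSection (levelData C hC hS mods 1).augY
        (levelData C hC hS mods 1).chi ⟨q, hq⟩))
      rw [ContinuousMulEquiv.apply_symm_apply] at e1
      exact e1.symm
  -- lift `γ` to the mod-`M` model (Cor. 2.18 (iv), first half)
  obtain ⟨αM, hαM⟩ := hsurj M (eta0 C hC mods f hf M) (eta0_mem C hC hS mods f hf M) γ hPiY
  refine ⟨{ iso := αM.e
            map_D := map_congr_modelD_of_etaleIso C hC hS hl hp2 hpl hζ mods f hf M αM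
            map_theta := αM.map_sTheta }, fun x => ?_⟩
  haveI := subsingleton_MuN_one (p := p)
  refine SemidirectProduct.ext (Subsingleton.elim _ _) (Subtype.ext ?_)
  change (((αM.e x).right : (levelData C hC hS mods M).PiY) : C.Huu) =
    ((φ.iso (red C hC hS mods h1 x)).right : C.Huu)
  have e2 : ((φ.iso (red C hC hS mods h1 x)).right : C.Huu) = γ ((red C hC hS mods h1 x).right : C.Huu) :=
    hγ (red C hC hS mods h1 x)
  rw [e2]
  exact hαM x

include hmods in
/-- **[EtTh] Cor. 2.18 (iv), finiteness of the fibre over `id_{𝕄_1}`, for the model family of `X̲̲_K`** (the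
hypothesis `hfin` of abc-iut-w4-d038's `prop15_i'_of_cor218_iv`): only finitely many automorphisms of the mod-`M`
model reduce to the identity of the mod-`1` model — they lie over the identity of `Π^tp_Y̲̲`, and those are the
finitely many `μ_M`-conjugates of twists by `Hom(Π^tp_Y̲̲/Π^tp_Ÿ̲̲, μ_M)` (abc-iut-L2-d1's `finite_autOverId`, from
the fibre description = the level-`M` named fact `ThetaEnvData.Cor218_iv_fibre`, [EtTh] Cor. 2.18 (iv) p. 63).
[cite: MochizukiEtTh2009, Cor 2.18(iv) p.63] -/
theorem finite_red_eq_red (hslimX : Literature.AlgebraicGeometry.Frobenioids.IsSlimGroup D.PiTemp)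
    (hfibre : ∀ M : ℕ+, (levelData C hC hS mods M).Cor218_iv_fibre) (M : ℕ+) :
    Set.Finite
      {φ : MonoThetaEnv.Iso ((modelFamily C hC hS hl hp2 hpl hζ mods f hf).modelEnv M)
          ((modelFamily C hC hS hl hp2 hpl hζ mods f hf).modelEnv M) |
        ∀ x, (reductions C hC hS hl hp2 hpl hζ mods f hf hmods hslimX).red (PNat.dvd_iff.mp (one_dvd M))
            (φ.iso x) =
          (reductions C hC hS hl hp2 hpl hζ mods f hf hmods hslimX).red (PNat.dvd_iff.mp (one_dvd M)) x} := by
  have hfinL := ThetaEnvData.finite_autOverId (T := levelData C hC hS mods M)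
    (hη := eta0_mem C hC hS mods f hf M) ((hfibre M (eta0 C hC mods f hf M) (eta0_mem C hC hS mods f hf M)).1)
  refine Set.Finite.of_finite_image (f := fun φ => (φ.iso.toMulEquiv : MulAut (levelData C hC hS mods M).env))
    (hfinL.subset ?_) ?_
  · rintro _ ⟨φ, hφ, rfl⟩
    refine ⟨⟨{ e := φ.iso
               map_D := map_transport_DY_of_iso C hC hS hl hp2 hpl hζ mods f hf M φ
               map_sTheta := φ.map_theta }, fun x => rfl⟩, fun x => ?_⟩
    have e1 := congrArg SemidirectProduct.right (hφ x)
    exact e1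
  · intro φ₁ _ φ₂ _ h
    exact MonoThetaEnv.Iso.eq_of_iso_apply_eq fun x => by
      have := congrArg (fun e : MulAut (levelData C hC hS mods M).env => e x) h
      exact this

/-! ## [IUTchII] Prop. 1.5 (i)′ for the genuine model family, modulo exactly L2's level facts -/

include hmods in
/-- **[IUTchII] Prop. 1.5 (i)′ FOR THE GENUINE MODEL FAMILY of `X̲̲_K` over `ℕ_{≥1}`** — node
IUTchII:Prop1.5(i) at the [EtTh] models: any two projective systems of mono-theta environments of `X̲̲_K` indexed
by ALL `M ∈ ℕ_{≥1}` whose transitions are morphisms of mono-theta environments are isomorphic by a compatible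
family of isomorphisms of mono-theta environments (`Prop15_i'` of `MonoThetaProjectiveR` for
`EtaleLevels.reductions`). INPUTS, all BY NAME and in the same currency as abc-iut-L2-d1's discharge of [EtTh]
Cor. 2.19 (ii) for the model tower (`DoubleUnderline.cor219_ii_model`): temp-slimness of `Π^tp_X`
(`IsSlimGroup D.PiTemp`, [SemiAnbd] Ex. 3.10, interface FACT), openness of `Π^tp_X → G_K` (`haugOpen`), and at
every level `M` the [EtTh] Cor. 2.18 (iv) named facts `ThetaEnvData.Cor218_iv_surjective` (FACT-policy: ⟸ Cor.
2.18 (i) + constant multiple rigidity, `Sec2LiftingSurjProofs`) and `ThetaEnvData.Cor218_iv_fibre` (⟸ Prop. 2.14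
(i), abc-iut-L2-t10 `cor218_iv_fibre_of_prop214_i`). Route: abc-iut-w4-d038's `prop15_i'_of_cor218_iv` (the
printed argument of [EtTh] p. 66 — the `R¹ lim`s of the relevant projective systems vanish — run over `(ℕ_{≥1}, ∣)`)
with its three clauses discharged here
(`red_descends`, `red_lifts`, `finite_red_eq_red`). [claim: Mochizuki2012, status: disputed] (IUTchII §1 Prop 1.5 (i), kurims p.29) -/
theorem prop15_i'_etaleLevels (hslimX : Literature.AlgebraicGeometry.Frobenioids.IsSlimGroup D.PiTemp)
    (haugOpen : IsOpenMap D.aug)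
    (hsurj : ∀ M : ℕ+, (levelData C hC hS mods M).Cor218_iv_surjective)
    (hfibre : ∀ M : ℕ+, (levelData C hC hS mods M).Cor218_iv_fibre)
    (A B : MonoThetaProjSystem (modelFamily C hC hS hl hp2 hpl hζ mods f hf)) :
    Literature.IUT.HodgeArakelov.Prop15_i' (reductions C hC hS hl hp2 hpl hζ mods f hf hmods hslimX) A B :=
  prop15_i'_of_lift_of_finite C hC hS hl hp2 hpl hζ mods f hf hmods hslimX haugOpen
    (red_lifts C hC hS hl hp2 hpl hζ mods f hf hmods hslimX hsurj)
    (finite_red_eq_red C hC hS hl hp2 hpl hζ mods f hf hmods hslimX hfibre) A B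

end EtaleLevels

end Literature.IUT.HodgeArakelov
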